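import Summits.KontsevichZagierPeriods.KontsevichZagierPeriods.Theorems.RootDecompWalshStrataHtypeConicSections

/-!
# Root decomposition (Walsh strata), part 52c — H-type fibre discriminants VII: the descent from the one-variable residuals

The head of the node at generation 9:

  `quadricBakerDescent_of_residuals₅ : R-HLx → R-HCx → R-Eθ → QuadricBakerDescent`

(`QuadricBakerDescent` = the route item `…Theses.RootDecompWalshStrata.QuadricBakerDescent`, the `d = 3`
slice).  Chain: `quadricBakerDescent_of_sqrtDescentW` (landed, QuadricWalls04: residual `hW`) ←
`sqrtDescentW_of_residuals` (part 43: `hW ⟸ R-H ∧ R-P ∧ R-Eθ`, E-type stratum closed) ← `sqrtDescentW_Ptype`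
(part 46: `R-P` closed) ← `sqrtDescentW_Htype` (part 50: `R-H ⟸ R-HL ∧ R-HC`, the vertex chart) ←
`InBaker.of_Hlines` (part 51b: `R-HL ⟸ R-HLx`) ← `InBaker.of_Hconics` (part 52b: `R-HC ⟸ R-HLx ∧ R-HCx`).
The two remaining one-variable families are integrals over semialgebraic subsets of `[0, 1]` of
`F(x, √(quadratic))` with `F ∈ ℚ(x, y)` — Euler-substitution terminals —, the third is the explicit corner
family of the E-type stratum (part 43).

References: [KontsevichZagier2001 §1.2 rules (1)–(3)], [BCR1998 §2.2].
-/

noncomputable section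

open Set MeasureTheory MvPolynomial Literature.NumberTheory.Transcendental
open Literature.ModelTheory.ExponentialFields (IsSemialgebraic isSemialgebraic_univ isSemialgebraic_empty)
open Summit.KontsevichZagierPeriods.RootDecompWalshStrata.ConicDescent.VertexChart

namespace Summit.KontsevichZagierPeriods.RootDecompWalshStrata.ConicDescent.BallCube

/-! #### 52.4 The descent from the one-variable residuals -/

/-- **`QuadricBakerDescent` from the one-variable residual families** (this node, generation 9, final form).
The three hypotheses are, in order:
* `R-HLx` — the line-edge family `∫ γ (e x³/3 + g x) √(e x² + g − m (κ₀ + κ₁ x)²) (κ₁ g − e κ₀ x)/(e x² + g)² dx`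
  over semialgebraic subsets of `[0, 1]` on which `e x² + g > m (κ₀ + κ₁ x)²` (part 51);
* `R-HCx` — the conic-edge family
  `∫ γ (e x³/3 + g x) (q₁ g − e q₀ x) (m ℓ + s q₂ √Δ)² / ((e x² + g)² √Δ) dx`, `ℓ = q₀ + q₁ x`,
  `Δ = (m + q₂²)(e x² + g) − m ℓ²`, `s = ±1`, over semialgebraic subsets of `[0, 1]` on which `e x² + g > 0`
  and `Δ > 0` (this part);
* `R-Eθ` — the E-type corner atoms of part 43.
All three are families of integrals of ONE real variable with algebraic integrands of degree ≤ 2 over `ℚ(x)`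
(resp. the explicit two-variable corner family), i.e. Euler-substitution terminals.
[KontsevichZagier2001 §1.2; this node] -/
theorem quadricBakerDescent_of_residuals₅
    (hx : (∀ (e g m γ k0 k1 : ℚ), 0 < e → 1 ≤ m →
      ∀ (S : Set (Fin 1 → ℝ)), IsSemialgebraic ℚ S →
        (∀ t ∈ S, (0 ≤ t 0 ∧ t 0 ≤ 1) ∧ 0 < (e : ℝ) * t 0 ^ 2 + g ∧
          (m : ℝ) * ((k0 : ℝ) + k1 * t 0) ^ 2 < (e : ℝ) * t 0 ^ 2 + g) →
        ∀ r : KZ.IntegralRep 1, r.domain = S →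
          EqOn r.integrand (fun t => (γ : ℝ) * ((e : ℝ) / 3 * t 0 ^ 3 + g * t 0) *
            √((e : ℝ) * t 0 ^ 2 + g - m * ((k0 : ℝ) + k1 * t 0) ^ 2) *
            (((k1 : ℝ) * g - e * k0 * t 0) / ((e : ℝ) * t 0 ^ 2 + g) ^ 2)) S →
          InBaker (KZ.of r)))
    (hc : (∀ (e g m γ q0 q1 q2 s : ℚ), 0 < e → 1 ≤ m → (s = 1 ∨ s = -1) →
      ∀ (S : Set (Fin 1 → ℝ)), IsSemialgebraic ℚ S →
        (∀ t ∈ S, (0 ≤ t 0 ∧ t 0 ≤ 1) ∧ 0 < (e : ℝ) * t 0 ^ 2 + g ∧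
          0 < ((m : ℝ) + q2 ^ 2) * ((e : ℝ) * t 0 ^ 2 + g) - m * ((q0 : ℝ) + q1 * t 0) ^ 2) →
        ∀ r : KZ.IntegralRep 1, r.domain = S →
          EqOn r.integrand (fun t => (γ : ℝ) * ((e : ℝ) / 3 * t 0 ^ 3 + g * t 0) * ((q1 : ℝ) * g - e * q0 * t 0) *
            ((m : ℝ) * ((q0 : ℝ) + q1 * t 0) +
              s * q2 * √(((m : ℝ) + q2 ^ 2) * ((e : ℝ) * t 0 ^ 2 + g) - m * ((q0 : ℝ) + q1 * t 0) ^ 2)) ^ 2 /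
            (((e : ℝ) * t 0 ^ 2 + g) ^ 2 *
              √(((m : ℝ) + q2 ^ 2) * ((e : ℝ) * t 0 ^ 2 + g) - m * ((q0 : ℝ) + q1 * t 0) ^ 2))) S →
          InBaker (KZ.of r)))
    (hθ : ∀ (L : Quadric₃) (ℓ₁ ℓ₂ g : Wall) (γ : ℚ) (σ : Fin 6 → SignType) (r : KZ.IntegralRep 2),
      0 < L.dq.disc →
      ¬((L.bwall ℓ₁).precomp L.dq.lagM.inv ∈ goodWalls 1 L.dq.eκ L.dq.d11 L.dq.cst ∧
          (L.bwall ℓ₂).precomp L.dq.lagM.inv ∈ goodWalls 1 L.dq.eκ L.dq.d11 L.dq.cst) →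
      r.domain = atomFam (L.wfam ℓ₁ ℓ₂ g) σ →
      EqOn r.integrand (fun v => (γ : ℝ) * √(L.Dxy (v 0) (v 1))) r.domain → InBaker (KZ.of r)) :
    Summit.KontsevichZagierPeriods.KontsevichZagierPeriods.Theses.RootDecompWalshStrata.QuadricBakerDescent :=
  quadricBakerDescent_of_residuals₃ (InBaker.of_Hlines hx) (InBaker.of_Hconics hx hc) hθ

end Summit.KontsevichZagierPeriods.RootDecompWalshStrata.ConicDescent.BallCube
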